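import Mathlib
import Literature.NumberTheory.LFunctions.Zhang2022.Section14Eq148Leg2Aggregation
import Literature.NumberTheory.LFunctions.Zhang2022.ToolkitBErrorChainBlock
import Literature.NumberTheory.LFunctions.Zhang2022.Section7Eq711Assembly
import Literature.NumberTheory.LFunctions.Zhang2022.Section14Summability
import Literature.NumberTheory.LFunctions.Zhang2022.ToolkitDivisorMajorants
import HarnessLib

/-!
# Zhang (2022) §14, (14.8)/(14.6), the large-conductor leg `D³ ≤ r ≤ 2NP₄`: the `N`-generic dyadic
# AGGREGATION and CORE-large PROVED (`legSum_large_le`) — the last input of `prop141_of_core`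

Topic `Literature/NumberTheory/LFunctions/Zhang2022` (Landau–Siegel audit tree; verdict-neutral).
Y. Zhang, *Discrete mean estimates and the Landau–Siegel zero*, arXiv:2211.02515v1 (2022)
[Zhang2022LandauSiegel] — **an unrefereed manuscript under adjudication; nothing here asserts or denies
its Theorems 1–2 or its Proposition 14.1, and nothing here is about Landau–Siegel zeros.** ZHANG-L
discharge lane, helper under the leaf `Skeleton.Prop141` (nodes `Z22:(14.8)` second `r`-range and
`Z22:(14.6)`; GAP row G-adj2-4 "decl wanted: the (14.8)-left-side bound carried out … for `D³ ≤ r < 2DP₄`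
(Mellin + L5.4(i) + large sieve leg), and the (14.6) analogue"; WP14-PLAN §2.1 node CORE-large).

The manuscript (p. 79, tex L3960–L3963): "The range for `r` is divided into two parts according to
`1 < r < D³` and `D³ ≤ r < 2DP₄`. In a way similar to the proof of Proposition 7.1, … for `D³ ≤ r < 2DP₄`
we use the Mellin transform, Lemma 5.4 (i) and the large sieve inequality"; for (14.6) only "The proof of
(14.6) is analogous" (tex L3966). In §7 ((7.13)–(7.15), pp. 37–39) that method bounds, for each dyadic
block `R ≤ r < 2R` and each `h`, `R^{−3/2} Σ_{R≤r<2R} Σ*_θ |𝔰(r,h;θ)| ≪ h𝓛ᶜ(R^{1/2}P^{3/2} + R^{−1/2}P²)`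
(§7.u041), and then sums the blocks against the weight `(dhφ(hr)√r)⁻¹` — a step left to the reader there
and not written at all in §14. In §14 the weight is `N/(φ(hr)h√r)` with the modulus base `N = D` for
(14.5)/(14.8) and `N = D₂` for (14.6) (u017, `Typed.Sec14.rhs1417On` and its twisted form `rhs1417OnW`):
an extra factor `N ≤ D`, which only the restriction `r ≥ D³` repays (`D·R^{−1/2} ≤ D^{−1/2}`; and
`D·R^{1/2}P^{3/2} ≤ P²D^{−1/2}` because `R ≤ 2DP₄ = 2DPt₀T⁻²` and `2D⁴t₀ ≤ T²`). This file proves that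
bookkeeping abstractly and, with the coefficient-generic per-block estimate of the lane
(`BErrorChain.dyadic_block_bound_frakSGen_tau5_filter`: Lemma 5.3 localisation, Mellin step with
Lemma 5.4 (i), the large sieve in `l` and in `p`, Cauchy — §7.u037–u041 ported), PROVES the
`N`-generic large-conductor estimate itself:

* `weighted_dyadic_aggregate_le` — pure bookkeeping: for any non-negative `Y(d,h,r)`, weights
  `N/(φ(hr)h√r)` and `d⁻¹`, moduli `r ∈ S ⊆ [R₀, R_top]`, `h`-ranges with `hr ≤ Q`, per-block bounds
  `Σ_{r∈[R,2R)} Y(d,h,r) ≤ R√R·a(d)·h·M` on the dyadic scales `R = R₀2ⁱ` give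
  `Σ_d d⁻¹ Σ_{r∈S} Σ_h N/(φ(hr)h√r)·Y ≤ (log₂R_top + 1)·N·(1 + log Q)²·(2 + log Q)·M·Σ_d a(d)/d`
  (`n/φ(n) ≤ (1 + log n)²`, the tree's `Section7cStatements.weight713_le`; harmonic sum in `h`).
* `two_D_pow_four_t0_le_bigT_sq`, `two_D_P4_facts` — the range arithmetic `2D⁴t₀ ≤ T²`,
  `2DP₄·D³ ≤ P`, `2DP₄ ≤ P` for all large `D`.
* `legLarge_of_perBlock` — the §14 form, pointwise in `D`, ABSTRACT in the summand `Y(d,h,r) ≥ 0` and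
  LINEAR in the per-block constant `A` (so `D`-dependent factors such as `τ₅(D₁)` ride along): per-block
  bounds `R^{−3/2}Σ_{[R,2R)} Y ≤ A·τ₅(d)·h·𝓛ᵏ·(R^{1/2}P^{3/2} + R^{−1/2}P²)` on `D³ ≤ R`, `Rh ≤ P`
  give, for every weight numerator `0 ≤ N ≤ D`, `S ⊆ [D³, 2DP₄]`, `H(r) ⊆ [1, ⌈P/r⌉)`,
  `Σ_{d≤2P₄} d⁻¹ Σ_{r∈S} Σ_{h∈H(r)} N/(φ(hr)h√r)·Y ≤ 2304·A·P²·D^{−1/4}`.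
* `legSum_large_le` — **CORE-large PROVED** (the WP14-plan interface, `N`-generic; the exact hypothesis
  of the tree edges `Typed.Sec14.eq146leg2_of_core` (leg 2 of (14.6), `N = D₂`),
  `Typed.Sec14.wleg2_of_core` (W-leg2, `N = D`) and `Typed.Sec14.prop141_of_core`): for all large `D`
  under (A), every `1 ≤ N ≤ D`, `|cf(l)| ≤ Mτ₅(l)`, `|w(p)| ≤ W` on the window, `S ⊆ [D³, 2NP₄]`,
  `Σ_{r∈S} Σ_{h<P/r} N/(φ(hr)h√r) Σ*_{θ mod r, θ≠χ} |Σ_{(l,h)=1} cf(l)θ(l) Σ_{p∼P} χθ̄(p)w(p)Δ(l/(phr))|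
   ≤ C·M·W·P²·D^{−1/4}`.

Companions in the tree: the `N = D` hypothesis-form aggregation `Section14Eq148Leg2Aggregation` and the
`β = 0` node `Typed.Sec14.eq148leg2_holds` / W-leg2 `wleg2_holds` (`Section14Eq148Leg2Holds`, via the
`N = D` per-block instance `Section14LegTwoBlock`). With this file, `prop141_of_core legSum_large_le
leg1₂_holds` is a term of type `Skeleton.Prop141` (the leaf closer is the leaf owner's to file).
Theorems only; no definitions; standard axioms.

## References

* Y. Zhang, arXiv:2211.02515v1 (2022), §14 (14.8) and u017, p. 79, tex L3945–L3963; (14.6) p. 78,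
  tex L3915, L3966–L3969; §7 (7.13)–(7.15), §7.u041, pp. 37–39, tex L2005–L2058; §2 (2.6)–(2.8)
  (`P`, `T`, `t₀`), §14 (14.2) (`P₄ = PT⁻²t₀`).
  [cite: Zhang2022LandauSiegel, §14 (14.8) p.79; §14 (14.6) p.78; §7 (7.13)–(7.15) pp.37–39]
-/

noncomputable section

open Real Finset
open Literature.NumberTheory.LFunctions.Zhang2022
open Literature.NumberTheory.LFunctions.Zhang2022.Section7cStatements (dyadic weight713_le)

namespace Literature.NumberTheory.LFunctions.Zhang2022.Typed.Sec14

open Skeleton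

/-! ## Elementary tools -/

/-- The harmonic bound `Σ_{1≤h<N} 1/h ≤ 1 + log N` (local copy of the lane's lemma). [folklore] -/
private theorem sum_Ico_inv_le_one_add_log' (N : ℕ) :
    ∑ h ∈ Finset.Ico 1 N, (1 : ℝ) / h ≤ 1 + Real.log N := by
  rcases Nat.lt_or_ge N 2 with hN | hN
  · interval_cases N
    · simp
    · simp
  have hIco : Finset.Ico 1 N = Finset.Icc 1 (N - 1) := by
    ext h; simp only [Finset.mem_Ico, Finset.mem_Icc]; omega
  have h1 : ∑ h ∈ Finset.Icc 1 (N - 1), (1 : ℝ) / h = (harmonic (N - 1) : ℝ) := by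
    rw [harmonic_eq_sum_Icc]; push_cast
    exact Finset.sum_congr rfl fun h _ => by rw [one_div]
  rw [hIco, h1]
  have h2 := harmonic_le_one_add_log (N - 1)
  have h3 : Real.log ((N - 1 : ℕ) : ℝ) ≤ Real.log N :=
    Real.log_le_log (by exact_mod_cast (by omega : 0 < N - 1)) (by exact_mod_cast Nat.sub_le N 1)
  linarith

/-- The dyadic block of `r ≥ R₀ ≥ 1`: with `i = ⌊log₂(r/R₀)⌋`, `R₀2ⁱ ≤ r < 2R₀2ⁱ` (local copy).
[folklore] -/
private theorem mem_dyadic_of_log_eq' {R₀ r : ℕ} (hR₀ : 0 < R₀) (hr : R₀ ≤ r) :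
    r ∈ dyadic (((R₀ * 2 ^ Nat.log 2 (r / R₀) : ℕ) : ℝ)) := by
  set i := Nat.log 2 (r / R₀) with hi
  have hq : r / R₀ ≠ 0 := (Nat.div_pos hr hR₀).ne'
  have h1 : R₀ * 2 ^ i ≤ r := by
    have := Nat.pow_log_le_self 2 hq
    calc R₀ * 2 ^ i ≤ R₀ * (r / R₀) := Nat.mul_le_mul_left _ this
      _ ≤ r := Nat.mul_div_le r R₀
  have h2 : r < 2 * (R₀ * 2 ^ i) := by
    have := Nat.lt_pow_succ_log_self (b := 2) (by norm_num) (r / R₀)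
    rw [Nat.div_lt_iff_lt_mul hR₀, pow_succ] at this
    calc r < 2 ^ i * 2 * R₀ := this
      _ = 2 * (R₀ * 2 ^ i) := by ring
  rw [dyadic, Finset.mem_filter, Finset.mem_range]
  have h1' : ((R₀ * 2 ^ i : ℕ) : ℝ) ≤ r := by exact_mod_cast h1
  have h2' : (r : ℝ) < 2 * ((R₀ * 2 ^ i : ℕ) : ℝ) := by exact_mod_cast h2
  exact ⟨Nat.lt_ceil.mpr h2', h1', h2'⟩

/-- Members of a dyadic block: `R ≤ r < 2R`. [folklore] -/
private theorem mem_dyadic' {R : ℝ} {r : ℕ} (hr : r ∈ dyadic R) : R ≤ (r : ℝ) ∧ (r : ℝ) < 2 * R :=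
  (Finset.mem_filter.mp hr).2

/-! ## The abstract dyadic aggregation -/

/-- **Dyadic aggregation against the weight `N/(φ(hr)h√r)`** (the bookkeeping of §7 (7.13)→(7.15) /
§14 u017→(14.8), abstractly). Let `Y(d,h,r) ≥ 0`. Suppose the moduli `r ∈ S` satisfy `R₀ ≤ r ≤ R_top`
(`R₀ ≥ 1`), the `h`-ranges satisfy `1 ≤ h` and `h·r ≤ Q` (`Q ≥ 1`), and on every dyadic scale `R = R₀2ⁱ ≤ R_top`
the per-block bound `Σ_{r∈[R,2R)} Y(d,h,r) ≤ R√R·a(d)·h·M` holds whenever `h ≥ 1`, `hR ≤ Q` (`a, M ≥ 0`).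
Then `Σ_{d∈dS} d⁻¹ Σ_{r∈S} Σ_{h∈H(r)} N/(φ(hr)h√r)·Y(d,h,r) ≤ (log₂R_top + 1)·N·(1 + log Q)²·(2 + log Q)·M·Σ_{d∈dS} a(d)/d`:
the weight is `≤ N(1 + log Q)²/(h²R√R)` on the block (`n/φ(n) ≤ (1 + log n)²`), each block costs
`N(1 + log Q)²·a(d)·M·Σ_{h≤Q} 1/h`, and there are at most `log₂R_top + 1` blocks.
[cite: Zhang2022LandauSiegel, §7 (7.13)–(7.15) pp.37–38; §14 u017/(14.8) p.79] -/
theorem weighted_dyadic_aggregate_le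
    (Y : ℕ → ℕ → ℕ → ℝ) (hY : ∀ d h r, 0 ≤ Y d h r)
    {R₀ Rtop : ℕ} (hR₀ : 0 < R₀)
    {N Q M : ℝ} (hN : 0 ≤ N) (hQ : 1 ≤ Q) (hM : 0 ≤ M)
    (a : ℕ → ℝ) (ha : ∀ d, 0 ≤ a d)
    (dS : Finset ℕ)
    (S : Finset ℕ) (hS : ∀ r ∈ S, R₀ ≤ r ∧ r ≤ Rtop)
    (Hs : ℕ → Finset ℕ) (hHs : ∀ r ∈ S, ∀ h ∈ Hs r, 0 < h ∧ (h : ℝ) * r ≤ Q)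
    (hblock : ∀ d ∈ dS, ∀ (h i : ℕ), 0 < h → R₀ * 2 ^ i ≤ Rtop →
        (h : ℝ) * ((R₀ * 2 ^ i : ℕ) : ℝ) ≤ Q →
        ∑ r ∈ dyadic ((R₀ * 2 ^ i : ℕ) : ℝ), Y d h r ≤
          ((R₀ * 2 ^ i : ℕ) : ℝ) * Real.sqrt ((R₀ * 2 ^ i : ℕ) : ℝ) * (a d * h * M)) :
    ∑ d ∈ dS, (d : ℝ)⁻¹ * ∑ r ∈ S, ∑ h ∈ Hs r,
        N / ((Nat.totient (h * r) : ℝ) * h * Real.sqrt r) * Y d h r ≤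
      ((Nat.log 2 Rtop : ℕ) + 1 : ℝ) * N * (1 + Real.log Q) ^ 2 * (2 + Real.log Q) * M *
        ∑ d ∈ dS, a d / d := by
  set I : ℕ := Nat.log 2 Rtop with hI
  set Λ : ℝ := (1 + Real.log Q) ^ 2 with hΛ
  have hQ0 : 0 < Q := by linarith
  have hlogQ : 0 ≤ Real.log Q := Real.log_nonneg hQ
  have hΛ0 : 0 ≤ Λ := by positivity
  -- the bound for one `d`
  have hd_bound : ∀ d ∈ dS, ∑ r ∈ S, ∑ h ∈ Hs r,
      N / ((Nat.totient (h * r) : ℝ) * h * Real.sqrt r) * Y d h r ≤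
        ((I : ℕ) + 1 : ℝ) * N * Λ * (2 + Real.log Q) * M * a d := by
    intro d hd
    have had : 0 ≤ a d := ha d
    -- fiberwise over the block index
    have hmaps : ∀ r ∈ S, Nat.log 2 (r / R₀) ∈ Finset.range (I + 1) := by
      intro r hr
      rw [Finset.mem_range, Nat.lt_succ_iff, hI]
      exact Nat.log_mono_right (le_trans (Nat.div_le_self r R₀) (hS r hr).2)
    rw [← Finset.sum_fiberwise_of_maps_to hmaps]
    -- one block
    have hfib : ∀ i ∈ Finset.range (I + 1),
        ∑ r ∈ S.filter (fun r => Nat.log 2 (r / R₀) = i), ∑ h ∈ Hs r,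
            N / ((Nat.totient (h * r) : ℝ) * h * Real.sqrt r) * Y d h r ≤
          N * Λ * (2 + Real.log Q) * M * a d := by
      intro i _
      set R : ℝ := ((R₀ * 2 ^ i : ℕ) : ℝ) with hR
      set F : Finset ℕ := S.filter (fun r => Nat.log 2 (r / R₀) = i) with hF
      have hRpos : 0 < R := by rw [hR]; exact_mod_cast Nat.mul_pos hR₀ (pow_pos two_pos i)
      have hRR : 0 < R * Real.sqrt R := mul_pos hRpos (Real.sqrt_pos.mpr hRpos)
      -- members of the fiber lie in the dyadic block of `R`
      have hmem : ∀ r ∈ F, r ∈ S ∧ r ∈ dyadic R := by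
        intro r hr
        rw [hF, Finset.mem_filter] at hr
        refine ⟨hr.1, ?_⟩
        rw [hR, ← hr.2]
        exact mem_dyadic_of_log_eq' hR₀ (hS r hr.1).1
      -- swap the sums: `h` outside
      set Hall : Finset ℕ := F.biUnion Hs with hHall
      have hswap : ∑ r ∈ F, ∑ h ∈ Hs r,
          N / ((Nat.totient (h * r) : ℝ) * h * Real.sqrt r) * Y d h r =
          ∑ h ∈ Hall, ∑ r ∈ F.filter (fun r => h ∈ Hs r),
            N / ((Nat.totient (h * r) : ℝ) * h * Real.sqrt r) * Y d h r := by
        refine Finset.sum_comm' ?_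
        intro r h
        constructor
        · rintro ⟨hr, hh⟩
          refine ⟨Finset.mem_filter.mpr ⟨hr, hh⟩, ?_⟩
          rw [hHall, Finset.mem_biUnion]
          exact ⟨r, hr, hh⟩
        · rintro ⟨hr, -⟩
          rw [Finset.mem_filter] at hr
          exact ⟨hr.1, hr.2⟩
      rw [hswap]
      -- each `h ∈ Hall`: `0 < h`, `hR ≤ Q`, and the block is admissible
      have hH : ∀ h ∈ Hall, 0 < h ∧ (h : ℝ) * R ≤ Q ∧ R₀ * 2 ^ i ≤ Rtop ∧ (h : ℝ) ≤ Q := by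
        intro h hh
        rw [hHall, Finset.mem_biUnion] at hh
        obtain ⟨r₀, hr₀, hh₀⟩ := hh
        obtain ⟨hr₀S, hr₀dy⟩ := hmem r₀ hr₀
        obtain ⟨hh0, hhr⟩ := hHs r₀ hr₀S h hh₀
        obtain ⟨hRr₀, -⟩ := mem_dyadic' hr₀dy
        have h1 : (h : ℝ) * R ≤ Q :=
          le_trans (mul_le_mul_of_nonneg_left hRr₀ (Nat.cast_nonneg h)) hhr
        have h2 : R₀ * 2 ^ i ≤ Rtop := by
          have : ((R₀ * 2 ^ i : ℕ) : ℝ) ≤ (r₀ : ℝ) := hRr₀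
          exact le_trans (by exact_mod_cast this) (hS r₀ hr₀S).2
        have h3 : (h : ℝ) ≤ Q := by
          have hr1 : (1 : ℝ) ≤ r₀ := by exact_mod_cast le_trans hR₀ (hS r₀ hr₀S).1
          have hh0' : (0 : ℝ) ≤ h := Nat.cast_nonneg h
          nlinarith
        exact ⟨hh0, h1, h2, h3⟩
      -- the inner sum for one `h`
      have hinner : ∀ h ∈ Hall, ∑ r ∈ F.filter (fun r => h ∈ Hs r),
          N / ((Nat.totient (h * r) : ℝ) * h * Real.sqrt r) * Y d h r ≤
            N * Λ * a d * M / h := by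
        intro h hh
        obtain ⟨hh0, hhR, hblk, -⟩ := hH h hh
        have hh0' : (0 : ℝ) < h := by exact_mod_cast hh0
        -- weight bound on the fiber
        have hw : ∀ r ∈ F.filter (fun r => h ∈ Hs r),
            N / ((Nat.totient (h * r) : ℝ) * h * Real.sqrt r) * Y d h r ≤
              N * Λ / ((h : ℝ) ^ 2 * (R * Real.sqrt R)) * Y d h r := by
          intro r hr
          rw [Finset.mem_filter] at hr
          obtain ⟨hrS, hrdy⟩ := hmem r hr.1
          obtain ⟨-, hhr⟩ := hHs r hrS h hr.2
          obtain ⟨hRr, -⟩ := mem_dyadic' hrdy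
          have hr0 : 0 < r := lt_of_lt_of_le hR₀ (hS r hrS).1
          have hwt := weight713_le (d := 1) (h := h) (r := r) (R := R) (M := Q) Nat.one_pos hh0
            hRpos hRr (by push_cast; linarith) hr0
          refine mul_le_mul_of_nonneg_right ?_ (hY d h r)
          have hφ : 0 < (Nat.totient (h * r) : ℝ) := by
            exact_mod_cast Nat.totient_pos.mpr (Nat.mul_pos hh0 hr0)
          have hsq : 0 < Real.sqrt r := Real.sqrt_pos.mpr (by exact_mod_cast hr0)
          have e1 : N / ((Nat.totient (h * r) : ℝ) * h * Real.sqrt r) =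
              N * ((((1 * h : ℕ) : ℝ)) * (Nat.totient (h * r) : ℝ) * Real.sqrt r)⁻¹ := by
            push_cast; rw [div_eq_mul_inv]; ring_nf
          have e2 : N * Λ / ((h : ℝ) ^ 2 * (R * Real.sqrt R)) =
              N * ((1 + Real.log Q) ^ 2 / ((1 : ℕ) * (h : ℝ) ^ 2 * (R * Real.sqrt R))) := by
            rw [hΛ]; push_cast; ring
          rw [e1, e2]
          exact mul_le_mul_of_nonneg_left hwt hN
        calc ∑ r ∈ F.filter (fun r => h ∈ Hs r),
              N / ((Nat.totient (h * r) : ℝ) * h * Real.sqrt r) * Y d h r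
            ≤ ∑ r ∈ F.filter (fun r => h ∈ Hs r), N * Λ / ((h : ℝ) ^ 2 * (R * Real.sqrt R)) * Y d h r :=
              Finset.sum_le_sum hw
          _ = N * Λ / ((h : ℝ) ^ 2 * (R * Real.sqrt R)) *
                ∑ r ∈ F.filter (fun r => h ∈ Hs r), Y d h r := by rw [Finset.mul_sum]
          _ ≤ N * Λ / ((h : ℝ) ^ 2 * (R * Real.sqrt R)) * ∑ r ∈ dyadic R, Y d h r := by
              refine mul_le_mul_of_nonneg_left ?_ (by positivity)
              refine Finset.sum_le_sum_of_subset_of_nonneg (fun r hr => ?_) (fun r _ _ => hY d h r)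
              exact (hmem r (Finset.mem_filter.mp hr).1).2
          _ ≤ N * Λ / ((h : ℝ) ^ 2 * (R * Real.sqrt R)) * (R * Real.sqrt R * (a d * h * M)) :=
              mul_le_mul_of_nonneg_left (hblock d hd h i hh0 hblk hhR) (by positivity)
          _ = N * Λ * a d * M / h := by
              field_simp
      -- sum over `h ∈ Hall ⊆ [1, ⌊Q⌋]`
      have hHsub : Hall ⊆ Finset.Ico 1 (⌊Q⌋₊ + 1) := by
        intro h hh
        obtain ⟨hh0, -, -, hhQ⟩ := hH h hh
        rw [Finset.mem_Ico]
        exact ⟨hh0, Nat.lt_succ_of_le (Nat.le_floor hhQ)⟩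
      have hharm : ∑ h ∈ Hall, (1 : ℝ) / h ≤ 2 + Real.log Q := by
        calc ∑ h ∈ Hall, (1 : ℝ) / h ≤ ∑ h ∈ Finset.Ico 1 (⌊Q⌋₊ + 1), (1 : ℝ) / h :=
              Finset.sum_le_sum_of_subset_of_nonneg hHsub fun h _ _ => by positivity
          _ ≤ 1 + Real.log ((⌊Q⌋₊ + 1 : ℕ) : ℝ) := sum_Ico_inv_le_one_add_log' _
          _ ≤ 2 + Real.log Q := by
              have h1 : ((⌊Q⌋₊ + 1 : ℕ) : ℝ) ≤ 2 * Q := by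
                push_cast; linarith [Nat.floor_le hQ0.le]
              have h2 : Real.log ((⌊Q⌋₊ + 1 : ℕ) : ℝ) ≤ Real.log (2 * Q) :=
                Real.log_le_log (by positivity) h1
              rw [Real.log_mul (by norm_num) hQ0.ne'] at h2
              have h3 : Real.log 2 < 1 := by
                have := Real.log_two_lt_d9; norm_num at this; linarith
              linarith
      calc ∑ h ∈ Hall, ∑ r ∈ F.filter (fun r => h ∈ Hs r),
            N / ((Nat.totient (h * r) : ℝ) * h * Real.sqrt r) * Y d h r
          ≤ ∑ h ∈ Hall, N * Λ * a d * M / h := Finset.sum_le_sum hinner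
        _ = N * Λ * a d * M * ∑ h ∈ Hall, (1 : ℝ) / h := by
            rw [Finset.mul_sum]
            exact Finset.sum_congr rfl fun h _ => by ring
        _ ≤ N * Λ * a d * M * (2 + Real.log Q) :=
            mul_le_mul_of_nonneg_left hharm (by positivity)
        _ = N * Λ * (2 + Real.log Q) * M * a d := by ring
    refine (Finset.sum_le_sum hfib).trans ?_
    rw [Finset.sum_const, Finset.card_range, nsmul_eq_mul]
    push_cast
    ring_nf
    rfl
  -- sum over `d`
  calc ∑ d ∈ dS, (d : ℝ)⁻¹ * ∑ r ∈ S, ∑ h ∈ Hs r,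
        N / ((Nat.totient (h * r) : ℝ) * h * Real.sqrt r) * Y d h r
      ≤ ∑ d ∈ dS, (d : ℝ)⁻¹ * (((I : ℕ) + 1 : ℝ) * N * Λ * (2 + Real.log Q) * M * a d) := by
        refine Finset.sum_le_sum fun d hd => ?_
        exact mul_le_mul_of_nonneg_left (hd_bound d hd) (inv_nonneg.mpr (Nat.cast_nonneg d))
    _ = ((I : ℕ) + 1 : ℝ) * N * Λ * (2 + Real.log Q) * M * ∑ d ∈ dS, a d / d := by
        rw [Finset.mul_sum]
        exact Finset.sum_congr rfl fun d _ => by rw [div_eq_mul_inv]; ring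

/-! ## Sizes of the parameters -/

/-- **`2D⁴t₀ ≤ T²` for all large `D`** (`D = e^{𝓛}`, `t₀ = 𝓛⁵¹⁹`, `T = e^{𝓛^{1.1}}`): once
`𝓛 ≥ 3¹⁰` one has `𝓛^{0.1} ≥ 3`, so `2𝓛^{1.1} ≥ 6𝓛`, while `2t₀ = 2𝓛⁵¹⁹ ≤ e^{𝓛} = D` once `𝓛 ≥ 2·520!`;
hence `2D⁴t₀ ≤ e^{5𝓛} ≤ e^{2𝓛^{1.1}} = T²`. Consequently `2DP₄·D³ ≤ P` (`P₄ = PT⁻²t₀`): the dyadic range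
`D³ ≤ R < 2DP₄` of (14.8) has `R^{1/2}P^{3/2}·D ≤ P²D^{−1/2}`.
[cite: Zhang2022LandauSiegel, §2 (2.6)–(2.8) p.4–5; §14 (14.2) p.76] -/
theorem two_D_pow_four_t0_le_bigT_sq :
    ∃ D₀ : ℕ, ∀ D : ℕ, D₀ ≤ D → 2 * (D : ℝ) ^ 4 * t0 D ≤ bigT D ^ 2 := by
  obtain ⟨D₀, hD₀⟩ := exists_nat_forall_le_ell (max ((3 : ℝ) ^ (10 : ℕ)) (2 * (Nat.factorial 520 : ℝ)))
  refine ⟨max 1 D₀, fun D hD => ?_⟩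
  have hD1 : 1 ≤ D := le_trans (le_max_left _ _) hD
  have hℓ := hD₀ D (le_trans (le_max_right _ _) hD)
  have hℓ3 : (3 : ℝ) ^ (10 : ℕ) ≤ ell D := le_trans (le_max_left _ _) hℓ
  have hℓfac : 2 * (Nat.factorial 520 : ℝ) ≤ ell D := le_trans (le_max_right _ _) hℓ
  have hℓ1 : 1 ≤ ell D := le_trans (by norm_num) hℓ3
  have hℓ0 : 0 < ell D := by linarith
  have hDexp : (D : ℝ) = Real.exp (ell D) := by
    rw [ell, Real.exp_log (by exact_mod_cast hD1)]
  -- `𝓛^{0.1} ≥ 3`, hence `𝓛^{1.1} ≥ 3𝓛`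
  have h01 : (3 : ℝ) ≤ ell D ^ (0.1 : ℝ) := by
    have h3 : (3 : ℝ) = ((3 : ℝ) ^ (10 : ℕ)) ^ (0.1 : ℝ) := by
      rw [← Real.rpow_natCast, ← Real.rpow_mul (by norm_num)]
      norm_num
    rw [h3]
    exact Real.rpow_le_rpow (by positivity) hℓ3 (by norm_num)
  have h11 : 3 * ell D ≤ ell D ^ (1.1 : ℝ) := by
    rw [show (1.1 : ℝ) = 1 + 0.1 by norm_num, Real.rpow_add hℓ0, Real.rpow_one]
    nlinarith
  have hT2 : bigT D ^ 2 = Real.exp (2 * ell D ^ (1.1 : ℝ)) := by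
    rw [bigT, sq, ← Real.exp_add]; ring_nf
  -- `2𝓛⁵¹⁹ ≤ e^{𝓛}`
  have h519 : 2 * ell D ^ 519 ≤ Real.exp (ell D) := by
    have h1 : ell D ^ 520 ≤ (Nat.factorial 520 : ℝ) * Real.exp (ell D) := by
      have := Real.pow_div_factorial_le_exp (ell D) hℓ0.le 520
      rwa [div_le_iff₀ (by exact_mod_cast Nat.factorial_pos _), mul_comm] at this
    have h2 : 2 * ell D ^ 519 * ell D ≤ Real.exp (ell D) * ell D := by
      calc 2 * ell D ^ 519 * ell D = 2 * ell D ^ 520 := by ring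
        _ ≤ 2 * ((Nat.factorial 520 : ℝ) * Real.exp (ell D)) := by linarith
        _ = (2 * (Nat.factorial 520 : ℝ)) * Real.exp (ell D) := by ring
        _ ≤ ell D * Real.exp (ell D) := mul_le_mul_of_nonneg_right hℓfac (Real.exp_pos _).le
        _ = Real.exp (ell D) * ell D := mul_comm _ _
    exact le_of_mul_le_mul_right h2 hℓ0
  have hD4 : (D : ℝ) ^ 4 = Real.exp (4 * ell D) := by
    rw [hDexp, ← Real.exp_nat_mul]; norm_num
  calc 2 * (D : ℝ) ^ 4 * t0 D = (D : ℝ) ^ 4 * (2 * ell D ^ 519) := by rw [t0]; ring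
    _ ≤ Real.exp (4 * ell D) * Real.exp (ell D) := by
        rw [hD4]
        exact mul_le_mul_of_nonneg_left h519 (Real.exp_pos _).le
    _ = Real.exp (5 * ell D) := by rw [← Real.exp_add]; ring_nf
    _ ≤ bigT D ^ 2 := by
        rw [hT2, Real.exp_le_exp]
        nlinarith

/-- Consequences for the (14.8) range: for all large `D`, `0 ≤ P₄`, `2DP₄·D³ ≤ P` and `2DP₄ ≤ P`.
[cite: Zhang2022LandauSiegel, §14 (14.2), (14.8) pp.76–79] -/
theorem two_D_P4_facts : ∃ D₀ : ℕ, ∀ D : ℕ, D₀ ≤ D →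
    0 ≤ P4 D ∧ 2 * (D : ℝ) * P4 D * (D : ℝ) ^ 3 ≤ bigP D ∧ 2 * (D : ℝ) * P4 D ≤ bigP D := by
  obtain ⟨D₀, hD₀⟩ := two_D_pow_four_t0_le_bigT_sq
  refine ⟨max 1 D₀, fun D hD => ?_⟩
  have hD1 : (1 : ℝ) ≤ D := by exact_mod_cast le_trans (le_max_left _ _) hD
  have h := hD₀ D (le_trans (le_max_right _ _) hD)
  have hP0 : 0 < bigP D := Real.exp_pos _
  have hT0 : 0 < bigT D := Real.exp_pos _
  have ht0 : 0 ≤ t0 D := by rw [t0]; exact pow_nonneg (Real.log_natCast_nonneg D) _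
  have hP4 : 0 ≤ P4 D := by rw [P4]; positivity
  have hmain : 2 * (D : ℝ) * P4 D * (D : ℝ) ^ 3 ≤ bigP D := by
    rw [P4]
    have : 2 * (D : ℝ) * (bigP D / bigT D ^ 2 * t0 D) * (D : ℝ) ^ 3 =
        bigP D * ((2 * (D : ℝ) ^ 4 * t0 D) / bigT D ^ 2) := by
      field_simp
    rw [this]
    calc bigP D * ((2 * (D : ℝ) ^ 4 * t0 D) / bigT D ^ 2) ≤ bigP D * 1 := by
          refine mul_le_mul_of_nonneg_left ?_ hP0.le
          rw [div_le_one (pow_pos hT0 2)]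
          exact h
      _ = bigP D := mul_one _
  refine ⟨hP4, hmain, ?_⟩
  have hD3 : (1 : ℝ) ≤ (D : ℝ) ^ 3 := one_le_pow₀ hD1
  have h0 : 0 ≤ 2 * (D : ℝ) * P4 D := by positivity
  nlinarith

/-- `R^{1/2} = √R`, `R^{−1/2} = (√R)⁻¹`, `R^{3/2} = R·√R`, `R^{−3/2} = (R√R)⁻¹` for `R > 0` (rpow
bookkeeping). [folklore] -/
private theorem rpow_facts {R : ℝ} (hR : 0 < R) :
    R ^ (1 / 2 : ℝ) = Real.sqrt R ∧ R ^ (-(1 / 2 : ℝ)) = (Real.sqrt R)⁻¹ ∧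
      R ^ (3 / 2 : ℝ) = R * Real.sqrt R ∧ R ^ (-(3 / 2 : ℝ)) = (R * Real.sqrt R)⁻¹ := by
  have h1 : R ^ (1 / 2 : ℝ) = Real.sqrt R := (Real.sqrt_eq_rpow R).symm
  have h3 : R ^ (3 / 2 : ℝ) = R * Real.sqrt R := by
    rw [show (3 / 2 : ℝ) = 1 + 1 / 2 by norm_num, Real.rpow_add hR, Real.rpow_one, h1]
  refine ⟨h1, ?_, h3, ?_⟩
  · rw [Real.rpow_neg hR.le, h1]
  · rw [Real.rpow_neg hR.le, h3]

/-! ## The §14 large-sieve leg from per-block bounds, abstractly in the summand -/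

set_option maxHeartbeats 400000 in -- one long assembly (the sizes of six factors)
/-- **The dyadic large-sieve leg of (14.8)/(14.6), from per-block bounds — abstract in the summand,
pointwise in `D`.** For every exponent `k` there is `D₀` such that for `D ≥ D₀` the following holds.
Let `Y(d,h,r) ≥ 0` be any quantity attached to `d, h` and a modulus `r` (in (14.8):
`Σ*_{θ mod r, θ≠χ} |Σ_{(l,h)=1} κ*(dl)θ(l) Σ_{p∼P} χθ̄(p)(pt₀)^β Δ(l/(phr))|`; in (14.6) the same at level
`D₂` with coefficients `κ*(D₁dl)`), and `A ≥ 0`. IF on every dyadic block `R ≤ r < 2R` with `D³ ≤ R`,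
`Rh ≤ P` (`1 ≤ d ≤ 2P₄`, `1 ≤ h`) the per-block bound
`R^{−3/2} Σ_{R≤r<2R} Y(d,h,r) ≤ A·τ₅(d)·h·𝓛ᵏ·(R^{1/2}P^{3/2} + R^{−1/2}P²)` holds (the shape of §7.u041,
cf. `BErrorChain.dyadic_block_bound_frakSGen_tau5_filter`), THEN for every weight numerator `0 ≤ N ≤ D`,
every set of moduli `S ⊆ [D³, 2DP₄]` and all `h`-ranges `H(r) ⊆ [1, ⌈P/r⌉)`:
`Σ_{d≤2P₄} d⁻¹ Σ_{r∈S} Σ_{h∈H(r)} N/(φ(hr)h√r)·Y(d,h,r) ≤ 2304·A·P²·D^{−1/4}` — LINEAR in `A` (so a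
`D`-dependent factor, e.g. `τ₅(D₁)` for (14.6), may be carried in `A`). Blocks `R = D³2ⁱ`;
`D·R^{−1/2} ≤ D^{−1/2}`, `D·R^{1/2}P^{3/2} ≤ P²D^{−1/2}` by `2D⁴t₀ ≤ T²`; `𝓛^{k+81} ≤ D^{1/4}`. This is the
part of "for `D³ ≤ r < 2DP₄` we use … the large sieve inequality" (p. 79) AFTER the per-block estimate,
which the manuscript does not write (in §7 either). [cite: Zhang2022LandauSiegel, §14 (14.8) p.79,
tex L3960–L3963; §7 (7.13)–(7.15) pp.37–39] -/
theorem legLarge_of_perBlock (k : ℕ) : ∃ D₀ : ℕ, ∀ D : ℕ, D₀ ≤ D →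
    ∀ (Y : ℕ → ℕ → ℕ → ℝ), (∀ d h r, 0 ≤ Y d h r) → ∀ (A : ℝ), 0 ≤ A →
    (∀ (d h : ℕ) (R : ℝ), 1 ≤ d → (d : ℝ) ≤ 2 * P4 D → 1 ≤ h → (D : ℝ) ^ 3 ≤ R → R * h ≤ bigP D →
        R ^ (-(3 / 2 : ℝ)) * ∑ r ∈ dyadic R, Y d h r ≤
          A * MeanSquareMajorant.tau 5 d * (h : ℝ) * ell D ^ k *
            (R ^ (1 / 2 : ℝ) * bigP D ^ (3 / 2 : ℝ) + R ^ (-(1 / 2 : ℝ)) * bigP D ^ 2)) →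
    ∀ N : ℝ, 0 ≤ N → N ≤ D →
    ∀ S : Finset ℕ, (∀ r ∈ S, (D : ℝ) ^ 3 ≤ r ∧ (r : ℝ) ≤ 2 * D * P4 D) →
    ∀ Hs : ℕ → Finset ℕ, (∀ r ∈ S, Hs r ⊆ Finset.Ico 1 ⌈bigP D / r⌉₊) →
      ∑ d ∈ Finset.Icc 1 ⌊2 * P4 D⌋₊, (d : ℝ)⁻¹ * ∑ r ∈ S, ∑ h ∈ Hs r,
          N / ((Nat.totient (h * r) : ℝ) * h * Real.sqrt r) * Y d h r ≤
        2304 * A * bigP D ^ 2 * (D : ℝ) ^ (-(1 / 4 : ℝ)) := by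
  classical
  obtain ⟨D₁, hD₁⟩ := two_D_P4_facts
  obtain ⟨D₂, hD₂⟩ := eventually_log_rpow_le_rpow_quarter ((k + 81 : ℕ) : ℝ)
  refine ⟨max (max D₁ D₂) 3, fun D hD Y hY0 A hA0 hb N hN0 hND S hS Hs hHs => ?_⟩
  have hD₁D : D₁ ≤ D := le_trans (le_trans (le_max_left _ _) (le_max_left _ _)) hD
  have hD₂D : D₂ ≤ D := le_trans (le_trans (le_max_right _ _) (le_max_left _ _)) hD
  have hD3 : 3 ≤ D := le_trans (le_max_right _ _) hD
  obtain ⟨hP4, hDP4D3, hDP4⟩ := hD₁ D hD₁D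
  have hD0 : (0 : ℝ) < D := by exact_mod_cast (show 0 < D by omega)
  have hD1 : (1 : ℝ) ≤ D := by exact_mod_cast (show 1 ≤ D by omega)
  have hℓ1 : 1 ≤ ell D := by
    have h3 : (3 : ℝ) ≤ D := by exact_mod_cast hD3
    rw [ell, Real.le_log_iff_exp_le hD0]
    exact le_trans (le_of_lt (lt_trans Real.exp_one_lt_d9 (by norm_num))) h3
  have hℓ0 : 0 ≤ ell D := by linarith
  have hP0 : 0 < bigP D := Real.exp_pos _
  have hP1 : 1 ≤ bigP D := Real.one_le_exp (pow_nonneg hℓ0 9)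
  have hlogP : Real.log (bigP D) = ell D ^ 9 := by rw [bigP, Real.log_exp]
  have hL9 : 1 ≤ ell D ^ 9 := one_le_pow₀ hℓ1
  -- the parameters of the abstract aggregation
  set R₀ : ℕ := D ^ 3 with hR₀
  set Rtop : ℕ := ⌊2 * (D : ℝ) * P4 D⌋₊ with hRtop
  have hR₀0 : 0 < R₀ := by rw [hR₀]; positivity
  have hR₀cast : ((R₀ : ℕ) : ℝ) = (D : ℝ) ^ 3 := by rw [hR₀]; push_cast; ring
  set sD3 : ℝ := Real.sqrt ((D : ℝ) ^ 3) with hsD3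
  have hsD3eq : sD3 = (D : ℝ) * Real.sqrt D := by
    rw [hsD3, show ((D : ℝ)) ^ 3 = ((D : ℝ) * Real.sqrt D) ^ 2 by
      rw [mul_pow, Real.sq_sqrt hD0.le]; ring]
    exact Real.sqrt_sq (by positivity)
  have hsD3pos : 0 < sD3 := by rw [hsD3]; positivity
  set M : ℝ := ell D ^ k * (Real.sqrt (2 * (D : ℝ) * P4 D) * bigP D ^ (3 / 2 : ℝ) +
      sD3⁻¹ * bigP D ^ 2) with hM
  have hM0 : 0 ≤ M := by positivity
  set a : ℕ → ℝ := fun d => A * MeanSquareMajorant.tau 5 d with ha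
  have ha0 : ∀ d, 0 ≤ a d := fun d => mul_nonneg hA0 (MeanSquareMajorant.tau_nonneg 5 d)
  clear_value sD3 M a
  have hSb : ∀ r ∈ S, R₀ ≤ r ∧ r ≤ Rtop := by
    intro r hr
    obtain ⟨h1, h2⟩ := hS r hr
    refine ⟨?_, ?_⟩
    · have : ((R₀ : ℕ) : ℝ) ≤ r := by rw [hR₀cast]; exact h1
      exact_mod_cast this
    · rw [hRtop]; exact Nat.le_floor h2
  have hHsb : ∀ r ∈ S, ∀ h ∈ Hs r, 0 < h ∧ (h : ℝ) * r ≤ bigP D := by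
    intro r hr h hh
    have hh' := hHs r hr hh
    rw [Finset.mem_Ico] at hh'
    have hr0 : (0 : ℝ) < r := by
      have : (D : ℝ) ^ 3 ≤ r := (hS r hr).1
      exact lt_of_lt_of_le (by positivity) this
    refine ⟨hh'.1, ?_⟩
    have h1 : (h : ℝ) < bigP D / r := Nat.lt_ceil.mp hh'.2
    rw [lt_div_iff₀ hr0] at h1
    exact h1.le
  -- the per-block hypothesis in the abstract form
  have hblk : ∀ d ∈ Finset.Icc 1 ⌊2 * P4 D⌋₊, ∀ (h i : ℕ), 0 < h → R₀ * 2 ^ i ≤ Rtop →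
      (h : ℝ) * ((R₀ * 2 ^ i : ℕ) : ℝ) ≤ bigP D →
      ∑ r ∈ dyadic ((R₀ * 2 ^ i : ℕ) : ℝ), Y d h r ≤
        ((R₀ * 2 ^ i : ℕ) : ℝ) * Real.sqrt ((R₀ * 2 ^ i : ℕ) : ℝ) * (a d * h * M) := by
    intro d hd h i hh hiR hhR
    rw [Finset.mem_Icc] at hd
    set R : ℝ := ((R₀ * 2 ^ i : ℕ) : ℝ) with hR
    have hRD3 : (D : ℝ) ^ 3 ≤ R := by
      rw [hR]; push_cast
      have : (1 : ℝ) ≤ 2 ^ i := one_le_pow₀ (by norm_num)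
      have h0 : (0 : ℝ) ≤ (D : ℝ) ^ 3 := by positivity
      nlinarith
    have hRpos : 0 < R := lt_of_lt_of_le (by positivity) hRD3
    have hRtop' : R ≤ 2 * (D : ℝ) * P4 D := by
      have h1 : R ≤ ((Rtop : ℕ) : ℝ) := by rw [hR]; exact_mod_cast hiR
      exact h1.trans (Nat.floor_le (by positivity))
    obtain ⟨r12, rn12, r32, rn32⟩ := rpow_facts hRpos
    have hd1 : 1 ≤ d := hd.1
    have hd2 : (d : ℝ) ≤ 2 * P4 D :=
      le_trans (by exact_mod_cast hd.2) (Nat.floor_le (by positivity))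
    have hb1 := hb d h R hd1 hd2 hh hRD3 (by rw [mul_comm]; exact hhR)
    rw [rn32, r12, rn12] at hb1
    have hRR : 0 < R * Real.sqrt R := mul_pos hRpos (Real.sqrt_pos.mpr hRpos)
    rw [inv_mul_le_iff₀ hRR] at hb1
    -- sizes inside the block: `√R ≤ √(2DP₄)`, `(√R)⁻¹ ≤ (√(D³))⁻¹`
    have hs1 : Real.sqrt R ≤ Real.sqrt (2 * (D : ℝ) * P4 D) := Real.sqrt_le_sqrt hRtop'
    have hs2 : (Real.sqrt R)⁻¹ ≤ sD3⁻¹ := by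
      rw [hsD3]
      exact inv_anti₀ (Real.sqrt_pos.mpr (by positivity)) (Real.sqrt_le_sqrt hRD3)
    have hτ0 : 0 ≤ MeanSquareMajorant.tau 5 d := MeanSquareMajorant.tau_nonneg 5 d
    have hh0 : (0 : ℝ) ≤ h := Nat.cast_nonneg h
    have hP32 : 0 ≤ bigP D ^ (3 / 2 : ℝ) := Real.rpow_nonneg hP0.le _
    calc ∑ r ∈ dyadic R, Y d h r
        ≤ R * Real.sqrt R * (A * MeanSquareMajorant.tau 5 d * (h : ℝ) * ell D ^ k *
            (Real.sqrt R * bigP D ^ (3 / 2 : ℝ) + (Real.sqrt R)⁻¹ * bigP D ^ 2)) := hb1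
      _ ≤ R * Real.sqrt R * (A * MeanSquareMajorant.tau 5 d * (h : ℝ) * ell D ^ k *
            (Real.sqrt (2 * (D : ℝ) * P4 D) * bigP D ^ (3 / 2 : ℝ) + sD3⁻¹ * bigP D ^ 2)) := by
          refine mul_le_mul_of_nonneg_left ?_ hRR.le
          refine mul_le_mul_of_nonneg_left ?_ (by positivity)
          gcongr
      _ = R * Real.sqrt R * (a d * h * M) := by rw [ha, hM]; ring
  -- the abstract aggregation
  refine (weighted_dyadic_aggregate_le Y hY0 hR₀0 (N := N) (Q := bigP D) (M := M) hN0 hP1 hM0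
    a ha0 (Finset.Icc 1 ⌊2 * P4 D⌋₊) S hSb Hs hHsb hblk).trans ?_
  -- the sizes of the factors
  -- `Σ_d a d / d ≤ A·(2𝓛⁹)⁵`
  have hτsum : ∑ d ∈ Finset.Icc 1 ⌊2 * P4 D⌋₊, a d / d ≤ A * (2 * ell D ^ 9) ^ 5 := by
    have h1 : ∑ d ∈ Finset.Icc 1 ⌊2 * P4 D⌋₊, a d / d =
        A * ∑ d ∈ Finset.Icc 1 ⌊2 * P4 D⌋₊, MeanSquareMajorant.tau 5 d / d := by
      rw [Finset.mul_sum]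
      exact Finset.sum_congr rfl fun d _ => by rw [ha]; ring
    rw [h1]
    refine mul_le_mul_of_nonneg_left ?_ hA0
    refine (MeanSquareMajorant.sum_tau_div_Icc_le_log_pow 5 ⌊2 * P4 D⌋₊).trans ?_
    have hlogle : Real.log ((⌊2 * P4 D⌋₊ : ℕ) : ℝ) ≤ ell D ^ 9 := by
      rcases Nat.eq_zero_or_pos ⌊2 * P4 D⌋₊ with h0 | hpos
      · rw [h0]; simp; positivity
      · rw [← hlogP]
        refine Real.log_le_log (by exact_mod_cast hpos) ?_
        calc ((⌊2 * P4 D⌋₊ : ℕ) : ℝ) ≤ 2 * P4 D := Nat.floor_le (by positivity)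
          _ ≤ 2 * (D : ℝ) * P4 D := by nlinarith
          _ ≤ bigP D := hDP4
    have h0 : 0 ≤ 1 + Real.log ((⌊2 * P4 D⌋₊ : ℕ) : ℝ) := by
      have := Real.log_natCast_nonneg ⌊2 * P4 D⌋₊; linarith
    exact pow_le_pow_left₀ h0 (by linarith) 5
  -- `log₂ Rtop + 1 ≤ 3𝓛⁹`
  have hI : ((Nat.log 2 Rtop : ℕ) + 1 : ℝ) ≤ 3 * ell D ^ 9 := by
    rcases Nat.eq_zero_or_pos Rtop with h0 | hpos
    · rw [h0]; simp; linarith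
    · have h2I : ((2 : ℕ) ^ Nat.log 2 Rtop : ℕ) ≤ Rtop := Nat.pow_log_le_self 2 hpos.ne'
      have h2I' : (2 : ℝ) ^ (Nat.log 2 Rtop) ≤ Rtop := by exact_mod_cast h2I
      have hRtopP : ((Rtop : ℕ) : ℝ) ≤ bigP D :=
        le_trans (Nat.floor_le (by positivity)) hDP4
      have hlog2 : (Nat.log 2 Rtop : ℝ) * Real.log 2 ≤ ell D ^ 9 := by
        rw [← Real.log_pow, ← hlogP]
        exact Real.log_le_log (by positivity) (h2I'.trans hRtopP)
      have hl2 : (1 / 2 : ℝ) < Real.log 2 := by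
        have := Real.log_two_gt_d9; norm_num at this; linarith
      have hI0 : (0 : ℝ) ≤ Nat.log 2 Rtop := Nat.cast_nonneg _
      nlinarith
  -- `(1 + log P)² ≤ 4𝓛¹⁸`, `2 + log P ≤ 3𝓛⁹`
  have hΛ : (1 + Real.log (bigP D)) ^ 2 ≤ 4 * (ell D ^ 9) ^ 2 := by
    rw [hlogP]
    calc (1 + ell D ^ 9) ^ 2 ≤ (2 * ell D ^ 9) ^ 2 :=
          pow_le_pow_left₀ (by positivity) (by linarith) 2
      _ = 4 * (ell D ^ 9) ^ 2 := by ring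
  have hQ2 : 2 + Real.log (bigP D) ≤ 3 * ell D ^ 9 := by rw [hlogP]; linarith
  -- `N·M ≤ 2·𝓛ᵏ·P²·D^{−1/2}`
  have hDm12 : (D : ℝ) ^ (-(1 / 2 : ℝ)) = (Real.sqrt D)⁻¹ := by
    rw [Real.rpow_neg hD0.le, ← Real.sqrt_eq_rpow]
  have hsqD : 0 < Real.sqrt D := Real.sqrt_pos.mpr hD0
  have hNM : N * M ≤ 2 * ell D ^ k * bigP D ^ 2 * (D : ℝ) ^ (-(1 / 2 : ℝ)) := by
    rw [hDm12]
    -- first summand: `D·√(2DP₄)·P^{3/2} ≤ P²/√D`, from `2DP₄·D³ ≤ P`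
    have hP32 : bigP D ^ (3 / 2 : ℝ) = bigP D * Real.sqrt (bigP D) := (rpow_facts hP0).2.2.1
    have h1 : (D : ℝ) * (Real.sqrt (2 * (D : ℝ) * P4 D) * bigP D ^ (3 / 2 : ℝ)) ≤
        bigP D ^ 2 * (Real.sqrt D)⁻¹ := by
      -- `D·√(2DP₄)·√D ≤ √P`
      have hkey : (D : ℝ) * Real.sqrt (2 * (D : ℝ) * P4 D) * Real.sqrt D ≤ Real.sqrt (bigP D) := by
        have hsq : ((D : ℝ) * Real.sqrt (2 * (D : ℝ) * P4 D) * Real.sqrt D) ^ 2 =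
            2 * (D : ℝ) * P4 D * (D : ℝ) ^ 3 := by
          rw [mul_pow, mul_pow, Real.sq_sqrt (by positivity), Real.sq_sqrt hD0.le]; ring
        have h0 : 0 ≤ (D : ℝ) * Real.sqrt (2 * (D : ℝ) * P4 D) * Real.sqrt D := by positivity
        rw [← Real.sqrt_sq h0, hsq]
        exact Real.sqrt_le_sqrt hDP4D3
      rw [hP32, le_mul_inv_iff₀ hsqD]
      calc (D : ℝ) * (Real.sqrt (2 * (D : ℝ) * P4 D) * (bigP D * Real.sqrt (bigP D))) * Real.sqrt D
          = ((D : ℝ) * Real.sqrt (2 * (D : ℝ) * P4 D) * Real.sqrt D) *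
              (bigP D * Real.sqrt (bigP D)) := by ring
        _ ≤ Real.sqrt (bigP D) * (bigP D * Real.sqrt (bigP D)) :=
            mul_le_mul_of_nonneg_right hkey (by positivity)
        _ = bigP D ^ 2 := by
            rw [show Real.sqrt (bigP D) * (bigP D * Real.sqrt (bigP D)) =
              bigP D * (Real.sqrt (bigP D)) ^ 2 by ring, Real.sq_sqrt hP0.le]; ring
    -- second summand: `D·(√(D³))⁻¹·P² = P²/√D`
    have hDne : (D : ℝ) ≠ 0 := hD0.ne'
    have h2 : (D : ℝ) * (sD3⁻¹ * bigP D ^ 2) = bigP D ^ 2 * (Real.sqrt D)⁻¹ := by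
      rw [hsD3eq, mul_inv, show (D : ℝ) * ((D : ℝ)⁻¹ * (Real.sqrt D)⁻¹ * bigP D ^ 2) =
        ((D : ℝ) * (D : ℝ)⁻¹) * ((Real.sqrt D)⁻¹ * bigP D ^ 2) by ring, mul_inv_cancel₀ hDne, one_mul,
        mul_comm]
    calc N * M ≤ (D : ℝ) * M := mul_le_mul_of_nonneg_right hND hM0
      _ = ell D ^ k * ((D : ℝ) * (Real.sqrt (2 * (D : ℝ) * P4 D) * bigP D ^ (3 / 2 : ℝ)) +
            (D : ℝ) * (sD3⁻¹ * bigP D ^ 2)) := by rw [hM]; ring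
      _ ≤ ell D ^ k * (bigP D ^ 2 * (Real.sqrt D)⁻¹ + bigP D ^ 2 * (Real.sqrt D)⁻¹) := by
            rw [h2]
            exact mul_le_mul_of_nonneg_left (add_le_add h1 le_rfl) (pow_nonneg hℓ0 k)
      _ = 2 * ell D ^ k * bigP D ^ 2 * (Real.sqrt D)⁻¹ := by ring
  -- `𝓛^{k+81} ≤ D^{1/4}`
  have hℓpow : ell D ^ (k + 81) ≤ (D : ℝ) ^ (1 / 4 : ℝ) := by
    have := hD₂ D hD₂D
    rw [Real.rpow_natCast] at this
    exact this
  -- assemble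
  have hP2 : 0 ≤ bigP D ^ 2 := sq_nonneg _
  have hDm : 0 ≤ (D : ℝ) ^ (-(1 / 2 : ℝ)) := Real.rpow_nonneg hD0.le _
  calc ((Nat.log 2 Rtop : ℕ) + 1 : ℝ) * N * (1 + Real.log (bigP D)) ^ 2 * (2 + Real.log (bigP D)) * M *
        ∑ d ∈ Finset.Icc 1 ⌊2 * P4 D⌋₊, a d / d
      = ((Nat.log 2 Rtop : ℕ) + 1 : ℝ) * (1 + Real.log (bigP D)) ^ 2 * (2 + Real.log (bigP D)) *
          (N * M) * ∑ d ∈ Finset.Icc 1 ⌊2 * P4 D⌋₊, a d / d := by ring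
    _ ≤ (3 * ell D ^ 9) * (4 * (ell D ^ 9) ^ 2) * (3 * ell D ^ 9) *
          (2 * ell D ^ k * bigP D ^ 2 * (D : ℝ) ^ (-(1 / 2 : ℝ))) * (A * (2 * ell D ^ 9) ^ 5) := by
        have hA0' : 0 ≤ ((Nat.log 2 Rtop : ℕ) + 1 : ℝ) := by positivity
        have hB0 : 0 ≤ (1 + Real.log (bigP D)) ^ 2 := sq_nonneg _
        have hC0 : 0 ≤ 2 + Real.log (bigP D) := by rw [hlogP]; positivity
        have hNM0 : 0 ≤ N * M := mul_nonneg hN0 hM0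
        have hS0 : 0 ≤ ∑ d ∈ Finset.Icc 1 ⌊2 * P4 D⌋₊, a d / d :=
          Finset.sum_nonneg fun d _ => div_nonneg (ha0 d) (Nat.cast_nonneg d)
        gcongr
    _ = (2304 * A) * bigP D ^ 2 * (ell D ^ (k + 81) * (D : ℝ) ^ (-(1 / 2 : ℝ))) := by ring
    _ ≤ (2304 * A) * bigP D ^ 2 * ((D : ℝ) ^ (1 / 4 : ℝ) * (D : ℝ) ^ (-(1 / 2 : ℝ))) := by
        refine mul_le_mul_of_nonneg_left (mul_le_mul_of_nonneg_right hℓpow hDm) (by positivity)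
    _ = 2304 * A * bigP D ^ 2 * (D : ℝ) ^ (-(1 / 4 : ℝ)) := by
        rw [← Real.rpow_add hD0]; norm_num

/-! ## CORE-large: the `N`-generic large-conductor leg, PROVED -/

/-- The summand of the u017-type majorants (`rhs1417OnW`, the (14.6) legs, `legSum` of the WP14 plan) is
the generic series `BErrorChain.frakSGen` with coefficients `cf` and prime weight `χ(p)w(p)`
(reordering `χθ̄(p)·w(p) = (χ(p)w(p))·θ̄(p)` inside the finite `p`-sum).
[cite: Zhang2022LandauSiegel, §14 u017/(14.8) p.79, tex L3956] -/
theorem tsum_leg_eq_frakSGen {D : ℕ} (χ : DirichletCharacter ℂ D) (w cf : ℕ → ℂ)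
    (r h : ℕ) (θ : DirichletCharacter ℂ r) :
    (∑' l : ℕ, if Nat.Coprime l h then
        cf l * θ (l : ZMod r) *
          ∑ p ∈ primeWindow D, χ (p : ZMod D) * θ⁻¹ (p : ZMod r) * w p *
            DeltaW D ((l : ℝ) / ((p : ℝ) * h * r)) else 0) =
      BErrorChain.frakSGen D cf (fun p => χ (p : ZMod D) * w p) r h θ := by
  unfold BErrorChain.frakSGen
  refine tsum_congr fun l => ?_
  split_ifs with hl
  · congr 1
    exact Finset.sum_congr rfl fun p _ => by ring
  · rfl

/-- **CORE-large — the large-conductor leg `D³ ≤ r ≤ 2NP₄` of (14.8)/(14.6), `N`-generic, PROVED**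
(the WP14-plan interface `legSum_large_le`, consumed verbatim by `Typed.Sec14.wleg2_of_core`
(W-leg2 of Proposition 14.1 at general `β`, `N = D`), `Typed.Sec14.eq146leg2_of_core` (leg 2 of (14.6),
`N = D₂`) and `Typed.Sec14.prop141_of_core`). For all large `D` under (A): for every modulus base
`1 ≤ N ≤ D`, coefficients `|cf(l)| ≤ Mτ₅(l)`, prime weight `|w(p)| ≤ W` on the window, and moduli
`S ⊆ [D³, 2NP₄]`,
`Σ_{r∈S} Σ_{h<P/r} N/(φ(hr)h√r) Σ*_{θ mod r, θ≠χ} |Σ_{(l,h)=1} cf(l)θ(l) Σ_{p∼P} χθ̄(p)w(p)Δ(l/(phr))|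
 ≤ C·M·W·P²·D^{−1/4}` ("for `D³ ≤ r < 2DP₄` we use the Mellin transform, Lemma 5.4 (i) and the large
sieve inequality", p. 79): per dyadic block `R ≤ r < 2R` the estimate is
`BErrorChain.dyadic_block_bound_frakSGen_tau5_filter` (Lemma 5.3 localisation, Mellin step with
Lemma 5.4 (i), the large sieve in `l` and in `p`, Cauchy — §7.u037–u041 made coefficient-generic), and the
aggregation over blocks and `h` is `legLarge_of_perBlock` (at `d = 1`; `c = 1/4`, `k = 0`).
[cite: Zhang2022LandauSiegel, §14 (14.8) p.79, tex L3956–L3963; §14 (14.6) p.78] -/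
theorem legSum_large_le :
    ∃ c : ℝ, 0 < c ∧ ∃ k : ℕ, ∃ C : ℝ, ForAllLarge fun D _ χ => AssumptionA D χ →
      ∀ (N : ℕ) (M W : ℝ) (w cf : ℕ → ℂ), 0 ≤ M → 0 ≤ W → 1 ≤ N → N ≤ D →
        (∀ l : ℕ, ‖cf l‖ ≤ M * MeanSquareMajorant.tau 5 l) →
        (∀ p ∈ primeWindow D, ‖w p‖ ≤ W) →
        ∀ S : Finset ℕ, (∀ r ∈ S, D ^ 3 ≤ r ∧ (r : ℝ) ≤ 2 * N * P4 D) →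
          ∑ r ∈ S, ∑ h ∈ Finset.Ico 1 ⌈bigP D / r⌉₊,
              (N : ℝ) / ((Nat.totient (h * r) : ℝ) * h * Real.sqrt r) *
                ∑ θ ∈ finsetOf {θ : DirichletCharacter ℂ r | θ.IsPrimitive ∧
                    DirichletCharacter.changeLevel (dvd_mul_left r D) θ ≠
                      DirichletCharacter.changeLevel (dvd_mul_right D r) χ},
                  ‖∑' l : ℕ, if Nat.Coprime l h then
                      cf l * θ (l : ZMod r) *
                        ∑ p ∈ primeWindow D, χ (p : ZMod D) * θ⁻¹ (p : ZMod r) * w p *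
                          DeltaW D ((l : ℝ) / ((p : ℝ) * h * r)) else 0‖
            ≤ C * M * W * ell D ^ k * bigP D ^ 2 * (D : ℝ) ^ (-c) := by
  classical
  obtain ⟨C₆, hC₆0, D₆, h6⟩ := BErrorChain.dyadic_block_bound_frakSGen_tau5_filter
  obtain ⟨Dℓ, hagg⟩ := legLarge_of_perBlock 5315
  obtain ⟨D₁, hD₁⟩ := two_D_P4_facts
  obtain ⟨D₃, hD₃⟩ := exists_nat_forall_le_ell 3
  refine ⟨1 / 4, by norm_num, 0, 2304 * C₆, max (max D₆ Dℓ) (max D₁ D₃),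
    fun D _ χ hD hq hp _ N M W w cf hM hW hN1 hND hcf hw S hS => ?_⟩
  have hD₆D : D₆ ≤ D := le_trans (le_trans (le_max_left _ _) (le_max_left _ _)) hD
  have hDℓD : Dℓ ≤ D := le_trans (le_trans (le_max_right _ _) (le_max_left _ _)) hD
  have hD₁D : D₁ ≤ D := le_trans (le_trans (le_max_left _ _) (le_max_right _ _)) hD
  have hD₃D : D₃ ≤ D := le_trans (le_trans (le_max_right _ _) (le_max_right _ _)) hD
  have hℓ3 : 3 ≤ ell D := hD₃ D hD₃D
  obtain ⟨hP4, -, hDP4⟩ := hD₁ D hD₁D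
  have hD1nat : 1 ≤ D := le_trans hN1 hND
  have hD1 : (1 : ℝ) ≤ D := by exact_mod_cast hD1nat
  have hD0 : (0 : ℝ) < D := by linarith
  have hN0 : (0 : ℝ) ≤ N := Nat.cast_nonneg N
  have hNDr : (N : ℝ) ≤ D := by exact_mod_cast hND
  have hP1 : 1 ≤ bigP D := Real.one_le_exp (pow_nonneg (by rw [ell]; exact Real.log_natCast_nonneg D) 9)
  have hP41 : 1 ≤ P4 D := one_le_P4_of_three_le hℓ3
  have h6D := h6 D χ hD₆D hq hp
  -- the summand family `Y(h,r)` (no `d` here)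
  set Y : ℕ → ℕ → ℝ := fun h r =>
    ∑ θ ∈ finsetOf {θ : DirichletCharacter ℂ r | θ.IsPrimitive ∧
        DirichletCharacter.changeLevel (dvd_mul_left r D) θ ≠
          DirichletCharacter.changeLevel (dvd_mul_right D r) χ},
      ‖∑' l : ℕ, if Nat.Coprime l h then
          cf l * θ (l : ZMod r) *
            ∑ p ∈ primeWindow D, χ (p : ZMod D) * θ⁻¹ (p : ZMod r) * w p *
              DeltaW D ((l : ℝ) / ((p : ℝ) * h * r)) else 0‖ with hY
  have hY0 : ∀ h r, 0 ≤ Y h r := fun h r => Finset.sum_nonneg fun θ _ => norm_nonneg _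
  -- the prime weight `χ(p)w(p)`
  have hw' : ∀ p ∈ primeWindow D, ‖χ (p : ZMod D) * w p‖ ≤ W := by
    intro p hpW
    rw [norm_mul]
    calc ‖χ (p : ZMod D)‖ * ‖w p‖ ≤ 1 * W :=
          mul_le_mul (DirichletCharacter.norm_le_one χ _) (hw p hpW) (norm_nonneg _) zero_le_one
      _ = W := one_mul _
  have hcf1 : ∀ l : ℕ, ‖cf l‖ ≤ M * MeanSquareMajorant.tau 5 (1 * l) := fun l => by
    rw [one_mul]; exact hcf l
  -- the per-block bound for `Y` (from the generic block bound at `d = 1`)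
  have hPB : ∀ (h : ℕ) (R : ℝ), 1 ≤ h → (D : ℝ) ^ 3 ≤ R → R * h ≤ bigP D →
      R ^ (-(3 / 2 : ℝ)) * ∑ r ∈ dyadic R, Y h r ≤
        (C₆ * M * W) * (h : ℝ) * ell D ^ 5315 *
          (R ^ (1 / 2 : ℝ) * bigP D ^ (3 / 2 : ℝ) + R ^ (-(1 / 2 : ℝ)) * bigP D ^ 2) := by
    intro h R hh1 hR3 hRh
    have hR1 : 1 ≤ R := le_trans (one_le_pow₀ hD1) hR3
    have h1 := h6D (fun r θ => DirichletCharacter.changeLevel (dvd_mul_left r D) θ ≠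
        DirichletCharacter.changeLevel (dvd_mul_right D r) χ)
      cf (fun p => χ (p : ZMod D) * w p) M W 1 h R hcf1 hw' hW
      Nat.one_pos (by simpa using hP1) hh1 hR1 hRh
    rw [MeanSquareMajorant.tau_apply_one, mul_one] at h1
    -- the sum of `Y` over the block is the left side of `h1` (same sets, same summands)
    refine le_of_eq_of_le ?_ (le_of_le_of_eq h1 (by ring))
    congr 1
    refine Finset.sum_congr rfl fun r _ => ?_
    simp only [hY]
    refine Finset.sum_congr ?_ fun θ _ => by rw [tsum_leg_eq_frakSGen]
    ext θ
    simp only [mem_finsetOf (Set.toFinite _), Set.mem_setOf_eq, Finset.mem_filter, Finset.mem_univ,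
      true_and]
  -- the per-block bound in the `d`-indexed form of `legLarge_of_perBlock` (`τ₅(d) ≥ 1`)
  have hPBd : ∀ (d h : ℕ) (R : ℝ), 1 ≤ d → (d : ℝ) ≤ 2 * P4 D → 1 ≤ h → (D : ℝ) ^ 3 ≤ R →
      R * h ≤ bigP D →
        R ^ (-(3 / 2 : ℝ)) * ∑ r ∈ dyadic R, (fun (_ : ℕ) h r => Y h r) d h r ≤
          (C₆ * M * W) * MeanSquareMajorant.tau 5 d * (h : ℝ) * ell D ^ 5315 *
            (R ^ (1 / 2 : ℝ) * bigP D ^ (3 / 2 : ℝ) + R ^ (-(1 / 2 : ℝ)) * bigP D ^ 2) := by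
    intro d h R hd1 _ hh1 hR3 hRh
    have h1 := hPB h R hh1 hR3 hRh
    have hτ : 1 ≤ MeanSquareMajorant.tau 5 d :=
      MeanSquareMajorant.one_le_tau (by norm_num) (by omega)
    have hR0 : 0 < R := lt_of_lt_of_le (by positivity) hR3
    have hrest : 0 ≤ (C₆ * M * W) * (h : ℝ) * ell D ^ 5315 *
        (R ^ (1 / 2 : ℝ) * bigP D ^ (3 / 2 : ℝ) + R ^ (-(1 / 2 : ℝ)) * bigP D ^ 2) := by
      have hℓ0 : 0 ≤ ell D := by linarith
      have : 0 ≤ R ^ (1 / 2 : ℝ) * bigP D ^ (3 / 2 : ℝ) + R ^ (-(1 / 2 : ℝ)) * bigP D ^ 2 := by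
        positivity
      positivity
    calc R ^ (-(3 / 2 : ℝ)) * ∑ r ∈ dyadic R, Y h r
        ≤ (C₆ * M * W) * (h : ℝ) * ell D ^ 5315 *
            (R ^ (1 / 2 : ℝ) * bigP D ^ (3 / 2 : ℝ) + R ^ (-(1 / 2 : ℝ)) * bigP D ^ 2) := h1
      _ = (C₆ * M * W) * (h : ℝ) * ell D ^ 5315 *
            (R ^ (1 / 2 : ℝ) * bigP D ^ (3 / 2 : ℝ) + R ^ (-(1 / 2 : ℝ)) * bigP D ^ 2) * 1 := by ring
      _ ≤ (C₆ * M * W) * (h : ℝ) * ell D ^ 5315 *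
            (R ^ (1 / 2 : ℝ) * bigP D ^ (3 / 2 : ℝ) + R ^ (-(1 / 2 : ℝ)) * bigP D ^ 2) *
            MeanSquareMajorant.tau 5 d := mul_le_mul_of_nonneg_left hτ hrest
      _ = _ := by ring
  -- the aggregation (in the `d`-indexed form; the target is its `d = 1` term)
  have hSr : ∀ r ∈ S, (D : ℝ) ^ 3 ≤ r ∧ (r : ℝ) ≤ 2 * D * P4 D := by
    intro r hr
    obtain ⟨h1, h2⟩ := hS r hr
    refine ⟨by exact_mod_cast h1, h2.trans ?_⟩
    have : 0 ≤ 2 * P4 D := by positivity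
    nlinarith
  have hA0 : 0 ≤ C₆ * M * W := by positivity
  have hmain := hagg D hDℓD (fun _ h r => Y h r) (fun _ h r => hY0 h r) (C₆ * M * W) hA0 hPBd
    (N : ℝ) hN0 hNDr S hSr (fun r => Finset.Ico 1 ⌈bigP D / r⌉₊) (fun r _ => subset_rfl)
  -- the `d = 1` term is at most the whole `d`-sum
  set T : ℝ := ∑ r ∈ S, ∑ h ∈ Finset.Ico 1 ⌈bigP D / r⌉₊,
    (N : ℝ) / ((Nat.totient (h * r) : ℝ) * h * Real.sqrt r) * Y h r with hT
  have hT0 : 0 ≤ T := by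
    rw [hT]
    refine Finset.sum_nonneg fun r _ => Finset.sum_nonneg fun h _ => mul_nonneg ?_ (hY0 h r)
    exact div_nonneg hN0 (mul_nonneg (mul_nonneg (Nat.cast_nonneg _) (Nat.cast_nonneg h))
      (Real.sqrt_nonneg r))
  have h1mem : 1 ∈ Finset.Icc 1 ⌊2 * P4 D⌋₊ := by
    rw [Finset.mem_Icc]
    refine ⟨le_rfl, Nat.le_floor ?_⟩
    push_cast; linarith
  have hle : T ≤ ∑ d ∈ Finset.Icc 1 ⌊2 * P4 D⌋₊, (d : ℝ)⁻¹ * T := by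
    calc T = ((1 : ℕ) : ℝ)⁻¹ * T := by simp
      _ ≤ ∑ d ∈ Finset.Icc 1 ⌊2 * P4 D⌋₊, (d : ℝ)⁻¹ * T :=
          Finset.single_le_sum (f := fun d : ℕ => (d : ℝ)⁻¹ * T)
            (fun d _ => mul_nonneg (inv_nonneg.mpr (Nat.cast_nonneg d)) hT0) h1mem
  calc T ≤ ∑ d ∈ Finset.Icc 1 ⌊2 * P4 D⌋₊, (d : ℝ)⁻¹ * T := hle
    _ ≤ 2304 * (C₆ * M * W) * bigP D ^ 2 * (D : ℝ) ^ (-(1 / 4 : ℝ)) := hmain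
    _ = 2304 * C₆ * M * W * ell D ^ 0 * bigP D ^ 2 * (D : ℝ) ^ (-(1 / 4 : ℝ)) := by ring

end Literature.NumberTheory.LFunctions.Zhang2022.Typed.Sec14
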